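import Mathlib
import HarnessLib

/-!
# Item `LrcModEntire` (stmt-NavierStokesRegularity-20428), skeleton twist_split v6, CLASS road to `stub_twistingTHGerm` —
# the ANCIENT Liouville lemma for the plane-oscillation law in similarity variables, for ANY compression, GIVEN a universal Lyapunov weight

Cell ns-regularity-ideate, seat ns-k2-port-2 g3 (bricks (K-b)+(K-c) of OSC-SCALING-NOTE-port2g3 §3; `--supports stmt-NavierStokesRegularity-20428 --as helper`;
sequel of `…TwistingTHPlaneOscillationEndgame` and of the LEAD ns-poloidal-K2-p3 g13's `…TwistingTHPlaneOscillationSimilarity` (steady case)).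
In Type-I similarity variables the plane-oscillation law (OSC) is the Fokker–Planck subsolution inequality `Q_τ + ½∂_ξ((ξ + Ŝ)Q) ≤ Q_ξξ` with `|Ŝ| ≤ A`,
`0 ≤ Q ≤ c`.  The sup-norm estimate sees the compression `Ŝ_ξ` (the «K < 1/2» wall of `…Endgame`); the DUAL (weighted-mass) estimate does not: for an even weight
`w > 0` decreasing in `|ξ|` the worst case of the dual operator over `|Ŝ| ≤ A` is `w″ + ½(ξ − A)w′` (`ξ > 0`), and the principal Neumann eigenfunction `w*` of that
half-line Ornstein–Uhlenbeck operator satisfies `w*″ + ½(ξ + Ŝ)w*′ ≤ −γ*·w*` for EVERY admissible `Ŝ` at once, with `γ*(A) > 0` (≍ e^{−A²/4}).  This file is the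
Liouville conclusion GIVEN such a weight (its existence — a half-line Sturm–Liouville fact — is the analytic debt (K-a), stated here as hypotheses on `w`):

* `eq_zero_of_ancient_oscSubsolution` — `Q, Ŝ : ℝ → ℝ → ℝ` (time `τ`, similarity height `ξ`), `Q(τ,·) ∈ C²`, `0 ≤ Q ≤ c`, `Q` differentiable in `τ` with
  derivative `Qt`, polynomial bounds `|Qt|, |Q_ξ|, |Q_ξξ|, |Ŝ_ξ| ≤ C(1+ξ²)^k`, `|Ŝ| ≤ A`, the subsolution inequality `Qt + ½((ξ+Ŝ)Q)_ξ ≤ Q_ξξ` for ALL τ (ancient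
  and eternal alike), and a weight `w ∈ C²`, `w > 0`, with `w″ + ½(ξ+s)w′ ≤ −γw` for all `|s| ≤ A` (`γ > 0`) and `(1+ξ²)^{k+1}(|w|+|w′|+|w″|)` integrable
  ⇒ `Q ≡ 0`.  Proof: `I(τ) = ∫ Q w` is differentiable with `I′ = ∫ Qt·w ≤ ∫ Q·(w″ + ½(ξ+Ŝ)w′) ≤ −γ I` (two integrations by parts on `ℝ`, boundary-free by
  integrability), so `e^{γτ}I` is non-increasing and `I(τ) ≤ e^{−γ(τ−τ₀)}·c‖w‖₁ → 0` as `τ₀ → −∞`.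
* `eq_zero_of_ancient_oscSubsolution_gaussian` — the same in the Gaussian-decay currency `|w|, |w′|, |w″| ≤ Cw·e^{−κξ²}` of the LEAD's explicit
  weight (`…TwistingTHOscUniversalWeight.exists_universalWeight`, K2-p3 g13), via `(1+ξ²)ⁿe^{−κξ²} ∈ L¹`.

WHAT THIS IS NOT: not a claim about Navier–Stokes regularity and not the stub — the endgame of the class road for ANY compression constant, modulo (K-a) and the
derivation/hypotheses of (OSC) in similarity variables (bears_on LADDER-NS N0, item 20428 / crux 19708).
-/

noncomputable section

-- the summit and its single sub-problem share the name (CONVENTIONS §1), as in every Theorems file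
set_option linter.dupNamespace false

namespace Summit.NavierStokesRegularity.NavierStokesRegularity.Theorems.PoloidalWindowDoorLrcModEntireTwistingTHOscAncientLiouville

open MeasureTheory Set Filter Topology

/-! ### Small analytic helpers -/

/-- A continuous function dominated by a constant multiple of an integrable one is integrable. -/
theorem integrable_of_abs_le {f G : ℝ → ℝ} (hf : Continuous f) (hG : Integrable G) (K : ℝ)
    (h : ∀ ξ, |f ξ| ≤ K * G ξ) : Integrable f :=
  Integrable.mono' (hG.const_mul K) hf.aestronglyMeasurable (Eventually.of_forall fun ξ => by
    rw [Real.norm_eq_abs]; exact h ξ)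

/-- `1 + |ξ| ≤ 2(1 + ξ²)`. -/
theorem one_add_abs_le (ξ : ℝ) : 1 + |ξ| ≤ 2 * (1 + ξ ^ 2) := by
  rcases le_or_gt |ξ| 1 with h | h
  · nlinarith [sq_nonneg ξ, abs_nonneg ξ]
  · have : |ξ| ≤ ξ ^ 2 := by rw [← sq_abs]; nlinarith
    linarith

/-- Product bound: `|f| ≤ K·P₁`, `P₁ ≤ P₂`, `P₂·|g| ≤ G`, `K ≥ 0` ⇒ `|f·g| ≤ K·G`. -/
theorem abs_mul_le_of_bounds {f g K P₁ P₂ G : ℝ} (hK : 0 ≤ K) (hf : |f| ≤ K * P₁) (hP : P₁ ≤ P₂)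
    (hg : P₂ * |g| ≤ G) : |f * g| ≤ K * G := by
  rw [abs_mul]
  calc |f| * |g| ≤ K * P₁ * |g| := mul_le_mul_of_nonneg_right hf (abs_nonneg g)
    _ ≤ K * P₂ * |g| := mul_le_mul_of_nonneg_right (mul_le_mul_of_nonneg_left hP hK) (abs_nonneg g)
    _ = K * (P₂ * |g|) := by ring
    _ ≤ K * G := mul_le_mul_of_nonneg_left hg hK

/-- The same with the factors swapped. -/
theorem abs_mul_le_of_bounds' {f g K P₁ P₂ G : ℝ} (hK : 0 ≤ K) (hf : |f| ≤ K * P₁) (hP : P₁ ≤ P₂)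
    (hg : P₂ * |g| ≤ G) : |g * f| ≤ K * G := by
  rw [mul_comm]; exact abs_mul_le_of_bounds hK hf hP hg

/-! ### The ancient Liouville lemma -/

/-- **ANCIENT LIOUVILLE FOR THE SIMILARITY-VARIABLE PLANE-OSCILLATION LAW, ANY COMPRESSION, GIVEN A UNIVERSAL WEIGHT.**  See the module docstring. -/
theorem eq_zero_of_ancient_oscSubsolution {Q Qt S : ℝ → ℝ → ℝ} {w : ℝ → ℝ} {A γ c C : ℝ} {k : ℕ}
    -- the weight (analytic debt (K-a): the even principal Neumann eigenfunction of `w″ + ½(ξ−A)w′` has these properties)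
    (hw : ContDiff ℝ 2 w) (hwpos : ∀ ξ, 0 < w ξ) (hγ : 0 < γ)
    (hLw : ∀ ξ s : ℝ, |s| ≤ A → deriv (deriv w) ξ + (1 / 2 : ℝ) * (ξ + s) * deriv w ξ ≤ -γ * w ξ)
    (hWint : Integrable fun ξ => (1 + ξ ^ 2) ^ (k + 1) * (|w ξ| + |deriv w ξ| + |deriv (deriv w) ξ|))
    -- the subsolution
    (hQ2 : ∀ τ, ContDiff ℝ 2 (Q τ)) (hQt : ∀ τ ξ, HasDerivAt (fun τ' => Q τ' ξ) (Qt τ ξ) τ) (hQtc : ∀ τ, Continuous (Qt τ))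
    (h0 : ∀ τ ξ, 0 ≤ Q τ ξ) (hc : ∀ τ ξ, Q τ ξ ≤ c)
    (hQtb : ∀ τ ξ, |Qt τ ξ| ≤ C * (1 + ξ ^ 2) ^ k) (hQ1b : ∀ τ ξ, |deriv (Q τ) ξ| ≤ C * (1 + ξ ^ 2) ^ k)
    (hQ2b : ∀ τ ξ, |deriv (deriv (Q τ)) ξ| ≤ C * (1 + ξ ^ 2) ^ k)
    (hS : ∀ τ, ContDiff ℝ 1 (S τ)) (hSA : ∀ τ ξ, |S τ ξ| ≤ A) (hS1b : ∀ τ ξ, |deriv (S τ) ξ| ≤ C * (1 + ξ ^ 2) ^ k)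
    (hsub : ∀ τ ξ, Qt τ ξ + (1 / 2 : ℝ) * deriv (fun ξ => (ξ + S τ ξ) * Q τ ξ) ξ ≤ deriv (deriv (Q τ)) ξ) :
    ∀ τ ξ, Q τ ξ = 0 := by
  have hc0 : 0 ≤ c := (h0 0 0).trans (hc 0 0)
  have hC0 : 0 ≤ C := by
    have := (abs_nonneg _).trans (hQtb 0 0)
    have hP : 0 < (1 + (0 : ℝ) ^ 2) ^ k := by positivity
    nlinarith
  have hA0 : 0 ≤ A := (abs_nonneg _).trans (hSA 0 0)
  set G : ℝ → ℝ := fun ξ => (1 + ξ ^ 2) ^ (k + 1) * (|w ξ| + |deriv w ξ| + |deriv (deriv w) ξ|) with hG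
  have hP1 : ∀ ξ : ℝ, 1 ≤ (1 + ξ ^ 2) ^ k := fun ξ => one_le_pow₀ (by nlinarith [sq_nonneg ξ])
  have hPk : ∀ ξ : ℝ, (1 + ξ ^ 2) ^ k ≤ (1 + ξ ^ 2) ^ (k + 1) := fun ξ =>
    pow_le_pow_right₀ (by nlinarith [sq_nonneg ξ]) (Nat.le_succ k)
  have hPk' : ∀ ξ : ℝ, (1 + |ξ|) * (1 + ξ ^ 2) ^ k ≤ 2 * (1 + ξ ^ 2) ^ (k + 1) := fun ξ => by
    have h1 := one_add_abs_le ξ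
    have h2 : 0 ≤ (1 + ξ ^ 2) ^ k := by positivity
    calc (1 + |ξ|) * (1 + ξ ^ 2) ^ k ≤ (2 * (1 + ξ ^ 2)) * (1 + ξ ^ 2) ^ k := mul_le_mul_of_nonneg_right h1 h2
      _ = 2 * (1 + ξ ^ 2) ^ (k + 1) := by ring
  have hP1' : ∀ ξ : ℝ, 1 ≤ (1 + ξ ^ 2) ^ (k + 1) := fun ξ => one_le_pow₀ (by nlinarith [sq_nonneg ξ])
  have hwd : Differentiable ℝ w := hw.differentiable (by norm_num)
  have hw1 : ContDiff ℝ 1 (deriv w) := by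
    have h2 : ContDiff ℝ (1 + 1) w := by rwa [one_add_one_eq_two]
    exact h2.deriv'
  have hw'd : Differentiable ℝ (deriv w) := hw1.differentiable (by norm_num)
  have hwc : Continuous w := hwd.continuous
  have hw'c : Continuous (deriv w) := hw'd.continuous
  have hw''c : Continuous (deriv (deriv w)) := hw1.continuous_deriv le_rfl
  have hGw : ∀ ξ, (1 + ξ ^ 2) ^ (k + 1) * |w ξ| ≤ G ξ := fun ξ => by
    simp only [hG]; nlinarith [abs_nonneg (deriv w ξ), abs_nonneg (deriv (deriv w) ξ), hP1' ξ]
  have hGw' : ∀ ξ, (1 + ξ ^ 2) ^ (k + 1) * |deriv w ξ| ≤ G ξ := fun ξ => by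
    simp only [hG]; nlinarith [abs_nonneg (w ξ), abs_nonneg (deriv (deriv w) ξ), hP1' ξ]
  have hGw'' : ∀ ξ, (1 + ξ ^ 2) ^ (k + 1) * |deriv (deriv w) ξ| ≤ G ξ := fun ξ => by
    simp only [hG]; nlinarith [abs_nonneg (w ξ), abs_nonneg (deriv w ξ), hP1' ξ]
  -- ## Step 1: for each `τ`, the weighted-mass inequality `∫ Qt·w ≤ −γ ∫ Q·w`
  have hstep : ∀ τ, Integrable (fun ξ => Q τ ξ * w ξ) ∧ Integrable (fun ξ => Qt τ ξ * w ξ) ∧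
      ∫ ξ, Qt τ ξ * w ξ ≤ -γ * ∫ ξ, Q τ ξ * w ξ := by
    intro τ
    have hq2 := hQ2 τ
    have hqd : Differentiable ℝ (Q τ) := hq2.differentiable (by norm_num)
    have hq1 : ContDiff ℝ 1 (deriv (Q τ)) := by
      have h2 : ContDiff ℝ (1 + 1) (Q τ) := by rw [one_add_one_eq_two]; exact hq2
      exact h2.deriv'
    have hq'd : Differentiable ℝ (deriv (Q τ)) := hq1.differentiable (by norm_num)
    have hqc : Continuous (Q τ) := hqd.continuous
    have hq'c : Continuous (deriv (Q τ)) := hq'd.continuous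
    have hq''c : Continuous (deriv (deriv (Q τ))) := hq1.continuous_deriv le_rfl
    have hsd : Differentiable ℝ (S τ) := (hS τ).differentiable (by norm_num)
    have hsc : Continuous (S τ) := hsd.continuous
    have hs'c : Continuous (deriv (S τ)) := (hS τ).continuous_deriv le_rfl
    set V : ℝ → ℝ := fun ξ => (ξ + S τ ξ) * Q τ ξ with hV
    have hVd : ∀ ξ, HasDerivAt V ((1 + deriv (S τ) ξ) * Q τ ξ + (ξ + S τ ξ) * deriv (Q τ) ξ) ξ := by
      intro ξ
      have h1 : HasDerivAt (fun ξ => ξ + S τ ξ) (1 + deriv (S τ) ξ) ξ := (hasDerivAt_id ξ).add (hsd ξ).hasDerivAt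
      exact h1.mul (hqd ξ).hasDerivAt
    have hV' : deriv V = fun ξ => (1 + deriv (S τ) ξ) * Q τ ξ + (ξ + S τ ξ) * deriv (Q τ) ξ := funext fun ξ => (hVd ξ).deriv
    have hVc : Continuous V := by rw [hV]; exact (continuous_id.add hsc).mul hqc
    have hV'c : Continuous (deriv V) := by
      rw [hV']; exact ((continuous_const.add hs'c).mul hqc).add ((continuous_id.add hsc).mul hq'c)
    have bQ : ∀ ξ, |Q τ ξ| ≤ c := fun ξ => by rw [abs_of_nonneg (h0 τ ξ)]; exact hc τ ξ
    have hP1e : ∀ ξ : ℝ, (1 + ξ ^ 2) ≤ (1 + ξ ^ 2) ^ (k + 1) := fun ξ => by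
      calc (1 + ξ ^ 2) = (1 + ξ ^ 2) ^ 1 := (pow_one _).symm
        _ ≤ (1 + ξ ^ 2) ^ (k + 1) := pow_le_pow_right₀ (by nlinarith [sq_nonneg ξ]) (by omega)
    have bV : ∀ ξ, |V ξ| ≤ 2 * c * (1 + A) * (1 + ξ ^ 2) ^ (k + 1) := by
      intro ξ
      have h1 : |ξ + S τ ξ| ≤ |ξ| + A := (abs_add_le _ _).trans (by linarith [hSA τ ξ])
      have h3 : |ξ| + A ≤ (1 + A) * (1 + |ξ|) := by nlinarith [abs_nonneg ξ, mul_nonneg hA0 (abs_nonneg ξ)]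
      have h4 := one_add_abs_le ξ
      have h13 : |ξ + S τ ξ| ≤ (1 + A) * (2 * (1 + ξ ^ 2) ^ (k + 1)) :=
        h1.trans (h3.trans (mul_le_mul_of_nonneg_left (h4.trans (by nlinarith [hP1e ξ])) (by linarith)))
      rw [hV]
      show |(ξ + S τ ξ) * Q τ ξ| ≤ _
      rw [abs_mul]
      calc |ξ + S τ ξ| * |Q τ ξ| ≤ ((1 + A) * (2 * (1 + ξ ^ 2) ^ (k + 1))) * c :=
            mul_le_mul h13 (bQ ξ) (abs_nonneg _) (by positivity)
        _ = 2 * c * (1 + A) * (1 + ξ ^ 2) ^ (k + 1) := by ring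
    have bV' : ∀ ξ, |deriv V ξ| ≤ (c * (1 + C) + 2 * C * (1 + A)) * (1 + ξ ^ 2) ^ (k + 1) := by
      intro ξ
      rw [hV']
      have h1 : |(1 + deriv (S τ) ξ) * Q τ ξ| ≤ (1 + C * (1 + ξ ^ 2) ^ k) * c := by
        rw [abs_mul]
        exact mul_le_mul ((abs_add_le _ _).trans (by rw [abs_one]; linarith [hS1b τ ξ])) (bQ ξ) (abs_nonneg _)
          (by nlinarith [hP1 ξ])
      have h2 : |(ξ + S τ ξ) * deriv (Q τ) ξ| ≤ (|ξ| + A) * (C * (1 + ξ ^ 2) ^ k) := by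
        rw [abs_mul]
        exact mul_le_mul ((abs_add_le _ _).trans (by linarith [hSA τ ξ])) (hQ1b τ ξ) (abs_nonneg _)
          (by linarith [abs_nonneg ξ])
      have h3 := hPk ξ
      have h4 := hPk' ξ
      have h5 := hP1 ξ
      set P := (1 + ξ ^ 2) ^ k with hP
      set P₂ := (1 + ξ ^ 2) ^ (k + 1) with hP₂
      have hP0 : 0 ≤ P := by positivity
      have h1' : (1 + C * P) * c ≤ c * (1 + C) * P₂ := by
        have : 1 + C * P ≤ (1 + C) * P₂ := by nlinarith [mul_nonneg hC0 (sub_nonneg.2 h3)]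
        nlinarith
      have h2' : (|ξ| + A) * (C * P) ≤ 2 * C * (1 + A) * P₂ := by
        have h6 : |ξ| + A ≤ (1 + A) * (1 + |ξ|) := by nlinarith [abs_nonneg ξ, mul_nonneg hA0 (abs_nonneg ξ)]
        calc (|ξ| + A) * (C * P) ≤ ((1 + A) * (1 + |ξ|)) * (C * P) := mul_le_mul_of_nonneg_right h6 (by positivity)
          _ = (1 + A) * C * ((1 + |ξ|) * P) := by ring
          _ ≤ (1 + A) * C * (2 * P₂) := mul_le_mul_of_nonneg_left h4 (by positivity)
          _ = 2 * C * (1 + A) * P₂ := by ring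
      calc |(1 + deriv (S τ) ξ) * Q τ ξ + (ξ + S τ ξ) * deriv (Q τ) ξ|
          ≤ (1 + C * P) * c + (|ξ| + A) * (C * P) := (abs_add_le _ _).trans (add_le_add h1 h2)
        _ ≤ c * (1 + C) * P₂ + 2 * C * (1 + A) * P₂ := add_le_add h1' h2'
        _ = (c * (1 + C) + 2 * C * (1 + A)) * P₂ := by ring
    have bQ1 : ∀ ξ, |Q τ ξ| ≤ c * 1 := fun ξ => by rw [mul_one]; exact bQ ξ
    have iQw : Integrable fun ξ => Q τ ξ * w ξ := integrable_of_abs_le (hqc.mul hwc) hWint c fun ξ =>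
      abs_mul_le_of_bounds hc0 (bQ1 ξ) (hP1' ξ) (hGw ξ)
    have iQtw : Integrable fun ξ => Qt τ ξ * w ξ := integrable_of_abs_le ((hQtc τ).mul hwc) hWint C fun ξ =>
      abs_mul_le_of_bounds hC0 (hQtb τ ξ) (hPk ξ) (hGw ξ)
    have iQ''w : Integrable fun ξ => w ξ * deriv (deriv (Q τ)) ξ := integrable_of_abs_le (hwc.mul hq''c) hWint C fun ξ =>
      abs_mul_le_of_bounds' hC0 (hQ2b τ ξ) (hPk ξ) (hGw ξ)
    have iQ'w' : Integrable fun ξ => deriv w ξ * deriv (Q τ) ξ := integrable_of_abs_le (hw'c.mul hq'c) hWint C fun ξ =>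
      abs_mul_le_of_bounds' hC0 (hQ1b τ ξ) (hPk ξ) (hGw' ξ)
    have iQ'w : Integrable fun ξ => w ξ * deriv (Q τ) ξ := integrable_of_abs_le (hwc.mul hq'c) hWint C fun ξ =>
      abs_mul_le_of_bounds' hC0 (hQ1b τ ξ) (hPk ξ) (hGw ξ)
    have iQw'' : Integrable fun ξ => deriv (deriv w) ξ * Q τ ξ := integrable_of_abs_le (hw''c.mul hqc) hWint c fun ξ =>
      abs_mul_le_of_bounds' hc0 (bQ1 ξ) (hP1' ξ) (hGw'' ξ)
    have iQw' : Integrable fun ξ => deriv w ξ * Q τ ξ := integrable_of_abs_le (hw'c.mul hqc) hWint c fun ξ =>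
      abs_mul_le_of_bounds' hc0 (bQ1 ξ) (hP1' ξ) (hGw' ξ)
    have hK1 : 0 ≤ c * (1 + C) + 2 * C * (1 + A) := by positivity
    have hK2 : 0 ≤ 2 * c * (1 + A) := by positivity
    have iwV' : Integrable fun ξ => w ξ * deriv V ξ :=
      integrable_of_abs_le (hwc.mul hV'c) hWint (c * (1 + C) + 2 * C * (1 + A)) fun ξ =>
        abs_mul_le_of_bounds' hK1 (bV' ξ) le_rfl (hGw ξ)
    have iw'V : Integrable fun ξ => deriv w ξ * V ξ :=
      integrable_of_abs_le (hw'c.mul hVc) hWint (2 * c * (1 + A)) fun ξ =>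
        abs_mul_le_of_bounds' hK2 (bV ξ) le_rfl (hGw' ξ)
    have iwV : Integrable fun ξ => w ξ * V ξ :=
      integrable_of_abs_le (hwc.mul hVc) hWint (2 * c * (1 + A)) fun ξ =>
        abs_mul_le_of_bounds' hK2 (bV ξ) le_rfl (hGw ξ)
    have ibp1 : ∫ ξ, w ξ * deriv (deriv (Q τ)) ξ = -∫ ξ, deriv w ξ * deriv (Q τ) ξ :=
      integral_mul_deriv_eq_deriv_mul_of_integrable (u := w) (v := deriv (Q τ)) (u' := deriv w) (v' := deriv (deriv (Q τ)))
        (fun ξ _ => (hwd ξ).hasDerivAt) (fun ξ _ => (hq'd ξ).hasDerivAt) iQ''w iQ'w' iQ'w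
    have ibp2 : ∫ ξ, deriv w ξ * deriv (Q τ) ξ = -∫ ξ, deriv (deriv w) ξ * Q τ ξ :=
      integral_mul_deriv_eq_deriv_mul_of_integrable (u := deriv w) (v := Q τ) (u' := deriv (deriv w)) (v' := deriv (Q τ))
        (fun ξ _ => (hw'd ξ).hasDerivAt) (fun ξ _ => (hqd ξ).hasDerivAt) iQ'w' iQw'' iQw'
    have ibp3 : ∫ ξ, w ξ * deriv V ξ = -∫ ξ, deriv w ξ * V ξ :=
      integral_mul_deriv_eq_deriv_mul_of_integrable (u := w) (v := V) (u' := deriv w) (v' := deriv V)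
        (fun ξ _ => (hwd ξ).hasDerivAt) (fun ξ _ => (hVd ξ).differentiableAt.hasDerivAt) iwV' iw'V iwV
    have hderivV : ∀ ξ, deriv (fun ξ => (ξ + S τ ξ) * Q τ ξ) ξ = deriv V ξ := fun ξ => by rw [hV]
    have hpt : ∀ ξ, Qt τ ξ * w ξ ≤ w ξ * deriv (deriv (Q τ)) ξ - (1 / 2 : ℝ) * (w ξ * deriv V ξ) := by
      intro ξ
      have h := hsub τ ξ
      rw [hderivV ξ] at h
      have hw0 := (hwpos ξ).le
      nlinarith [mul_le_mul_of_nonneg_right h hw0]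
    have hI1 : ∫ ξ, Qt τ ξ * w ξ ≤ ∫ ξ, (w ξ * deriv (deriv (Q τ)) ξ - (1 / 2 : ℝ) * (w ξ * deriv V ξ)) :=
      integral_mono iQtw (iQ''w.sub (iwV'.const_mul _)) hpt
    have hI2 : ∫ ξ, (w ξ * deriv (deriv (Q τ)) ξ - (1 / 2 : ℝ) * (w ξ * deriv V ξ)) =
        ∫ ξ, (deriv (deriv w) ξ * Q τ ξ + (1 / 2 : ℝ) * (deriv w ξ * V ξ)) := by
      rw [integral_sub iQ''w (iwV'.const_mul _), integral_const_mul, ibp1, ibp2, ibp3,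
        integral_add iQw'' (iw'V.const_mul _), integral_const_mul]
      ring
    have hpt2 : ∀ ξ, deriv (deriv w) ξ * Q τ ξ + (1 / 2 : ℝ) * (deriv w ξ * V ξ) ≤ -γ * (Q τ ξ * w ξ) := by
      intro ξ
      have h := hLw ξ (S τ ξ) (hSA τ ξ)
      have hq0 := h0 τ ξ
      have e : deriv (deriv w) ξ * Q τ ξ + (1 / 2 : ℝ) * (deriv w ξ * V ξ) =
          (deriv (deriv w) ξ + (1 / 2 : ℝ) * (ξ + S τ ξ) * deriv w ξ) * Q τ ξ := by rw [hV]; ring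
      rw [e]
      nlinarith [mul_le_mul_of_nonneg_right h hq0]
    have hI3 : ∫ ξ, (deriv (deriv w) ξ * Q τ ξ + (1 / 2 : ℝ) * (deriv w ξ * V ξ)) ≤ ∫ ξ, -γ * (Q τ ξ * w ξ) :=
      integral_mono (iQw''.add (iw'V.const_mul _)) (iQw.const_mul _) hpt2
    refine ⟨iQw, iQtw, ?_⟩
    calc ∫ ξ, Qt τ ξ * w ξ ≤ _ := hI1
      _ = _ := hI2
      _ ≤ ∫ ξ, -γ * (Q τ ξ * w ξ) := hI3
      _ = -γ * ∫ ξ, Q τ ξ * w ξ := integral_const_mul _ _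
  -- ## Step 2: `I(τ) = ∫ Q w` is differentiable with `I′ = ∫ Qt w`
  set I : ℝ → ℝ := fun τ => ∫ ξ, Q τ ξ * w ξ with hI
  have hIderiv : ∀ τ, HasDerivAt I (∫ ξ, Qt τ ξ * w ξ) τ := by
    intro τ₀
    have h := hasDerivAt_integral_of_dominated_loc_of_deriv_le (μ := volume) (F := fun τ ξ => Q τ ξ * w ξ)
      (F' := fun τ ξ => Qt τ ξ * w ξ) (x₀ := τ₀) (s := univ) (bound := fun ξ => C * (1 + ξ ^ 2) ^ k * |w ξ|) univ_mem
      (Eventually.of_forall fun τ => (hstep τ).1.aestronglyMeasurable) (hstep τ₀).1 (hstep τ₀).2.1.aestronglyMeasurable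
      (Eventually.of_forall fun ξ τ _ => by
        rw [Real.norm_eq_abs, abs_mul]
        exact mul_le_mul_of_nonneg_right (hQtb τ ξ) (abs_nonneg _))
      (integrable_of_abs_le ((continuous_const.mul ((continuous_const.add (continuous_pow 2)).pow k)).mul hwc.abs) hWint C
        fun ξ => by
          have hb : |C * (1 + ξ ^ 2) ^ k| ≤ C * (1 + ξ ^ 2) ^ k := by
            rw [abs_of_nonneg (by positivity)]
          have hg' : (1 + ξ ^ 2) ^ (k + 1) * |(|w ξ|)| ≤ G ξ := by rw [abs_abs]; exact hGw ξ
          have h := abs_mul_le_of_bounds (G := G ξ) hC0 hb (hPk ξ) hg'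
          simpa [mul_assoc] using h)
      (Eventually.of_forall fun ξ τ _ => (hQt τ ξ).mul_const (w ξ))
    exact h.2
  -- ## Step 3: `e^{γτ} I(τ)` is non-increasing, hence `I(τ) ≤ e^{−γ(τ−τ₀)} I(τ₀) ≤ e^{−γ(τ−τ₀)} c ‖w‖₁`
  have hInonneg : ∀ τ, 0 ≤ I τ := fun τ => integral_nonneg fun ξ => mul_nonneg (h0 τ ξ) (hwpos ξ).le
  have hIle : ∀ τ, I τ ≤ c * ∫ ξ, w ξ := by
    intro τ
    have hwi : Integrable w := integrable_of_abs_le hwc hWint 1 fun ξ => by nlinarith [hGw ξ, hP1' ξ, abs_nonneg (w ξ)]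
    calc I τ = ∫ ξ, Q τ ξ * w ξ := rfl
      _ ≤ ∫ ξ, c * w ξ := integral_mono (hstep τ).1 (hwi.const_mul c) fun ξ => by
          nlinarith [hc τ ξ, (hwpos ξ).le]
      _ = c * ∫ ξ, w ξ := integral_const_mul _ _
  set J : ℝ → ℝ := fun τ => Real.exp (γ * τ) * I τ with hJ
  have hJd : ∀ τ, HasDerivAt J (Real.exp (γ * τ) * (γ * I τ + ∫ ξ, Qt τ ξ * w ξ)) τ := by
    intro τ
    have he : HasDerivAt (fun τ => Real.exp (γ * τ)) (Real.exp (γ * τ) * γ) τ := by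
      have h := ((hasDerivAt_id τ).const_mul γ).exp
      simpa using h
    exact (he.mul (hIderiv τ)).congr_deriv (by ring)
  have hJanti : Antitone J := by
    refine antitone_of_deriv_nonpos (fun τ => (hJd τ).differentiableAt) fun τ => ?_
    rw [(hJd τ).deriv]
    have h := (hstep τ).2.2
    have : γ * I τ + ∫ ξ, Qt τ ξ * w ξ ≤ 0 := by simp only [hI] at h ⊢; linarith
    exact mul_nonpos_of_nonneg_of_nonpos (Real.exp_pos _).le this
  have hIbound : ∀ τ₀ τ, τ₀ ≤ τ → I τ ≤ Real.exp (-(γ * (τ - τ₀))) * (c * ∫ ξ, w ξ) := by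
    intro τ₀ τ hle
    have hJ' : J τ ≤ J τ₀ := hJanti hle
    simp only [hJ] at hJ'
    have he : Real.exp (γ * τ) = Real.exp (γ * τ₀) * Real.exp (γ * (τ - τ₀)) := by
      rw [← Real.exp_add]; ring_nf
    have hpos := Real.exp_pos (γ * (τ - τ₀))
    have hpos0 := Real.exp_pos (γ * τ₀)
    have h2 : Real.exp (γ * (τ - τ₀)) * I τ ≤ I τ₀ := by
      have h3 : Real.exp (γ * τ₀) * (Real.exp (γ * (τ - τ₀)) * I τ) ≤ Real.exp (γ * τ₀) * I τ₀ := by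
        rw [← mul_assoc, ← he]; exact hJ'
      exact le_of_mul_le_mul_left h3 hpos0
    have h1 : I τ ≤ Real.exp (-(γ * (τ - τ₀))) * I τ₀ := by
      rw [Real.exp_neg]
      have e3 : I τ = (Real.exp (γ * (τ - τ₀)))⁻¹ * (Real.exp (γ * (τ - τ₀)) * I τ) := by
        field_simp
      rw [e3]; exact mul_le_mul_of_nonneg_left h2 (inv_nonneg.2 hpos.le)
    exact h1.trans (mul_le_mul_of_nonneg_left (hIle τ₀) (Real.exp_pos _).le)
  have hIzero : ∀ τ, I τ = 0 := by
    intro τ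
    have hlim : Tendsto (fun τ₀ : ℝ => Real.exp (-(γ * (τ - τ₀))) * (c * ∫ ξ, w ξ)) atBot (𝓝 0) := by
      have h1 : Tendsto (fun τ₀ : ℝ => -(γ * (τ - τ₀))) atBot atBot := by
        have e : (fun τ₀ : ℝ => -(γ * (τ - τ₀))) = fun τ₀ => γ * τ₀ + -(γ * τ) := by funext τ₀; ring
        rw [e]
        exact tendsto_atBot_add_const_right _ _ (tendsto_id.const_mul_atBot hγ)
      have h2 := Real.tendsto_exp_atBot.comp h1
      simpa using h2.mul_const (c * ∫ ξ, w ξ)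
    have hle : I τ ≤ 0 := ge_of_tendsto hlim (eventually_atBot.2 ⟨τ, fun τ₀ h => hIbound τ₀ τ h⟩)
    exact le_antisymm hle (hInonneg τ)
  intro τ ξ
  have hf0 : (fun ξ => Q τ ξ * w ξ) =ᵐ[volume] 0 :=
    (integral_eq_zero_iff_of_nonneg (fun ξ => mul_nonneg (h0 τ ξ) (hwpos ξ).le) (hstep τ).1).1 (hIzero τ)
  have hcont : Continuous fun ξ => Q τ ξ * w ξ := ((hQ2 τ).continuous.mul hwc)
  have hzero : (fun ξ => Q τ ξ * w ξ) = 0 := (hcont.ae_eq_iff_eq volume continuous_const).1 hf0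
  have := congrFun hzero ξ
  simp only [Pi.zero_apply, mul_eq_zero] at this
  exact this.resolve_right (hwpos ξ).ne'

/-! ### The Gaussian-decay currency of the LEAD's explicit weight (`…TwistingTHOscUniversalWeight`) -/

/-- `(1 + ξ²)ⁿ ≤ 2ⁿ(1 + (ξ²)ⁿ)`. -/
theorem one_add_sq_pow_le (ξ : ℝ) (n : ℕ) : (1 + ξ ^ 2) ^ n ≤ 2 ^ n * (1 + (ξ ^ 2) ^ n) := by
  have h2 : (0 : ℝ) ≤ 2 ^ n := by positivity
  rcases le_or_gt (ξ ^ 2) 1 with h | h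
  · calc (1 + ξ ^ 2) ^ n ≤ (2 : ℝ) ^ n := pow_le_pow_left₀ (by positivity) (by linarith) n
      _ ≤ 2 ^ n * (1 + (ξ ^ 2) ^ n) := by nlinarith [pow_nonneg (sq_nonneg ξ) n]
  · calc (1 + ξ ^ 2) ^ n ≤ (2 * ξ ^ 2) ^ n := pow_le_pow_left₀ (by positivity) (by linarith) n
      _ = 2 ^ n * (ξ ^ 2) ^ n := mul_pow _ _ _
      _ ≤ 2 ^ n * (1 + (ξ ^ 2) ^ n) := by nlinarith [pow_nonneg (sq_nonneg ξ) n]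

/-- Polynomial × Gaussian is integrable: `(1 + ξ²)ⁿ·e^{−κξ²} ∈ L¹(ℝ)` for `κ > 0`. -/
theorem integrable_one_add_sq_pow_mul_gaussian {κ : ℝ} (hκ : 0 < κ) (n : ℕ) :
    Integrable fun ξ : ℝ => (1 + ξ ^ 2) ^ n * Real.exp (-κ * ξ ^ 2) := by
  have h0 : Integrable fun ξ : ℝ => Real.exp (-κ * ξ ^ 2) := integrable_exp_neg_mul_sq hκ
  have h1 : Integrable fun ξ : ℝ => ξ ^ ((2 * n : ℕ) : ℝ) * Real.exp (-κ * ξ ^ 2) :=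
    integrable_rpow_mul_exp_neg_mul_sq hκ (by have : (0:ℝ) ≤ ((2 * n : ℕ) : ℝ) := Nat.cast_nonneg _; linarith)
  have h1' : Integrable fun ξ : ℝ => (ξ ^ 2) ^ n * Real.exp (-κ * ξ ^ 2) := by
    refine h1.congr (Eventually.of_forall fun ξ => ?_)
    simp only [Real.rpow_natCast, pow_mul]
  have hsum : Integrable fun ξ : ℝ => (2 : ℝ) ^ n * (Real.exp (-κ * ξ ^ 2) + (ξ ^ 2) ^ n * Real.exp (-κ * ξ ^ 2)) :=
    (h0.add h1').const_mul _
  refine hsum.mono' (((continuous_const.add (continuous_pow 2)).pow n).mul (by fun_prop)).aestronglyMeasurable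
    (Eventually.of_forall fun ξ => ?_)
  have he : 0 < Real.exp (-κ * ξ ^ 2) := Real.exp_pos _
  rw [Real.norm_eq_abs, abs_of_nonneg (by positivity)]
  have := one_add_sq_pow_le ξ n
  nlinarith [pow_nonneg (sq_nonneg ξ) n]

/-- **The ancient Liouville lemma in the Gaussian-decay currency** of `…TwistingTHOscUniversalWeight.exists_universalWeight` (LEAD K2-p3 g13):
the weight hypotheses are `w ∈ C²`, `w > 0`, the universal inequality, and `|w|, |w′|, |w″| ≤ Cw·e^{−κξ²}` (`κ > 0`). -/
theorem eq_zero_of_ancient_oscSubsolution_gaussian {Q Qt S : ℝ → ℝ → ℝ} {w : ℝ → ℝ} {A γ c C κ Cw : ℝ} {k : ℕ}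
    (hw : ContDiff ℝ 2 w) (hwpos : ∀ ξ, 0 < w ξ) (hγ : 0 < γ)
    (hLw : ∀ ξ s : ℝ, |s| ≤ A → deriv (deriv w) ξ + (1 / 2 : ℝ) * (ξ + s) * deriv w ξ ≤ -γ * w ξ)
    (hκ : 0 < κ) (hdec : ∀ ξ, |w ξ| ≤ Cw * Real.exp (-κ * ξ ^ 2)) (hdec' : ∀ ξ, |deriv w ξ| ≤ Cw * Real.exp (-κ * ξ ^ 2))
    (hdec'' : ∀ ξ, |deriv (deriv w) ξ| ≤ Cw * Real.exp (-κ * ξ ^ 2))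
    (hQ2 : ∀ τ, ContDiff ℝ 2 (Q τ)) (hQt : ∀ τ ξ, HasDerivAt (fun τ' => Q τ' ξ) (Qt τ ξ) τ) (hQtc : ∀ τ, Continuous (Qt τ))
    (h0 : ∀ τ ξ, 0 ≤ Q τ ξ) (hc : ∀ τ ξ, Q τ ξ ≤ c)
    (hQtb : ∀ τ ξ, |Qt τ ξ| ≤ C * (1 + ξ ^ 2) ^ k) (hQ1b : ∀ τ ξ, |deriv (Q τ) ξ| ≤ C * (1 + ξ ^ 2) ^ k)
    (hQ2b : ∀ τ ξ, |deriv (deriv (Q τ)) ξ| ≤ C * (1 + ξ ^ 2) ^ k)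
    (hS : ∀ τ, ContDiff ℝ 1 (S τ)) (hSA : ∀ τ ξ, |S τ ξ| ≤ A) (hS1b : ∀ τ ξ, |deriv (S τ) ξ| ≤ C * (1 + ξ ^ 2) ^ k)
    (hsub : ∀ τ ξ, Qt τ ξ + (1 / 2 : ℝ) * deriv (fun ξ => (ξ + S τ ξ) * Q τ ξ) ξ ≤ deriv (deriv (Q τ)) ξ) :
    ∀ τ ξ, Q τ ξ = 0 := by
  have hWint : Integrable fun ξ => (1 + ξ ^ 2) ^ (k + 1) * (|w ξ| + |deriv w ξ| + |deriv (deriv w) ξ|) := by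
    have hmaj := (integrable_one_add_sq_pow_mul_gaussian hκ (k + 1)).const_mul (3 * Cw)
    have hwc : Continuous w := hw.continuous
    have hw1 : ContDiff ℝ 1 (deriv w) := by
      have h2 : ContDiff ℝ (1 + 1) w := by rwa [one_add_one_eq_two]
      exact h2.deriv'
    have hw'c : Continuous (deriv w) := hw1.continuous
    have hw''c : Continuous (deriv (deriv w)) := hw1.continuous_deriv le_rfl
    refine hmaj.mono' ((((continuous_const.add (continuous_pow 2)).pow (k + 1)).mul
      ((hwc.abs.add hw'c.abs).add hw''c.abs)).aestronglyMeasurable) (Eventually.of_forall fun ξ => ?_)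
    have hP : 0 ≤ (1 + ξ ^ 2) ^ (k + 1) := by positivity
    rw [Real.norm_eq_abs, abs_of_nonneg (by positivity)]
    have h3 : |w ξ| + |deriv w ξ| + |deriv (deriv w) ξ| ≤ 3 * Cw * Real.exp (-κ * ξ ^ 2) := by
      linarith [hdec ξ, hdec' ξ, hdec'' ξ]
    calc (1 + ξ ^ 2) ^ (k + 1) * (|w ξ| + |deriv w ξ| + |deriv (deriv w) ξ|)
        ≤ (1 + ξ ^ 2) ^ (k + 1) * (3 * Cw * Real.exp (-κ * ξ ^ 2)) := mul_le_mul_of_nonneg_left h3 hP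
      _ = 3 * Cw * ((1 + ξ ^ 2) ^ (k + 1) * Real.exp (-κ * ξ ^ 2)) := by ring
  exact eq_zero_of_ancient_oscSubsolution hw hwpos hγ hLw hWint hQ2 hQt hQtc h0 hc hQtb hQ1b hQ2b hS hSA hS1b hsub

end Summit.NavierStokesRegularity.NavierStokesRegularity.Theorems.PoloidalWindowDoorLrcModEntireTwistingTHOscAncientLiouville
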